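import Summits.HodgeConjecture.HodgeConjecture.Theses.BoundaryReadout
import Literature.AlgebraicGeometry.HodgeTheory.ComplexConjugationHolds
import HarnessLib

/-!
# Crux `HCOverNumberFields` (stmt-HodgeConjecture-1070) — the strategist's typed split (glue for `route edit --split`)

Landed under `Theorems/` (prover-only directory) verbatim from the crux workfile
`Cruxes/HCOverNumberFields/SplitGlue.lean` (planner-cstrat-stmt-HodgeConjecture-1070-b1-0), as requested
there, so that a planner's `route edit --split HCOverNumberFields … --glue-by
Summit.HodgeConjecture.HodgeConjecture.Theorems.hcOverNumberFields_of_subs` has its glue in the tree. A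
CONDITIONAL result: it does not close stmt-HodgeConjecture-1070 (an open problem — the Hodge conjecture for
varieties definable over number fields); its companion `BoundaryReadoutHCOverNumberFieldsTransfer.lean`
proves the item equivalent to `PeriodDeficiency.HodgeConjectureQbar` (stmt-HodgeConjecture-11596).

Glue for the DECOMPOSITION of the shared crux
`Summit.HodgeConjecture.HodgeConjecture.Theses.BoundaryReadout.HCOverNumberFields`
(stmt-HodgeConjecture-1070: the Hodge conjecture for smooth projective complex varieties definable over a
number field, `X ≅ X₀ ×_{K,σ} ℂ`; rank 4 of route BoundaryReadout, rank 3 of route QbarEnvelope, whose copy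
`QbarEnvelope.HCOverNumberFields` has the definitionally identical body) into three leaf statements along
DELIGNE'S ABSOLUTE-HODGE FUNNEL restricted to arithmetic varieties — the cut of the registered birth skeleton
`Cruxes/HCOverNumberFields/Lines/birth.lean` (planner-skel-stmt-HodgeConjecture-1070-0, 2026-08-17), promoted
to route level by the crux-strategist seat (planner-cstrat-stmt-HodgeConjecture-1070-b1-0, 2026-08-17; census
`Cruxes/HCOverNumberFields/STRATEGY-CENSUS.md`).

CHILDREN (the three hypotheses below, verbatim the `statement`s filed with `route edit --split HCOverNumberFields`;
the birth stubs with the local abbreviation `IsDefinableOverNumberField X` inlined as the crux's own hypothesis):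
* `ConjugateClassesExist` (support; THEOREM IN PRINT, infrastructure): for `X` smooth projective over `ℂ`, every
  `σ ∈ Aut ℂ`, every degree `k` and every `c ∈ Hᵏ(X(ℂ); ℂ)` there is a `σ`-conjugate class on `X^σ`
  (`IsConjugateClass`: Jouanolou's affine torsor, GAGA analytifications, a natural rationally normalised de Rham
  family, Grothendieck's algebraic de Rham theorem on the affine chart). [cite: Jouanolou1973, Lemme 1.5]
  [cite: Grothendieck1966, Thm. 1'] [cite: CharlesSchnell2014Notes, §11.2.2]
* `HodgeClassConjugatesNumberField` (crux; DELIGNE'S ABSOLUTENESS CONJECTURE ON ARITHMETIC VARIETIES — open):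
  on a smooth projective variety definable over a number field every `σ`-conjugate of a rational `(p,p)` class is
  `(2πi/σ(2πi))ᵖ ·` (a rational `(p,p)` class on `X^σ`) — the conjugation clause of `IsAbsoluteHodgeClass`, i.e.
  Charles–Schnell Conj. 11.2.17 restricted to arithmetic varieties. [cite: CharlesSchnell2014Notes, §11.2.5 Conj. 11.2.17]
  [cite: Deligne1982HodgeCycles, Thm. 2.11]
* `AbsoluteHodgeAlgebraicNumberField` (crux; THE ARITHMETIC HEART — open): absolute Hodge classes on smooth
  projective varieties definable over a number field are algebraic. By Voisin 2007 Prop. 1.2 (tree fact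
  `voisin2007_hodgeConjecture_absolute_of_qbar`) it is equivalent in print to "absolute Hodge classes are
  algebraic" on ALL smooth projective complex varieties (Deligne's question), and it is exactly what route
  BoundaryReadout's `AbsoluteReduction` consumes of the parent crux. [cite: Voisin2007HodgeLoci, Prop. 1.2]
  [cite: Deligne1982HodgeCycles, Prop. 2.9]

THEOREMS: `hcOverNumberFields_of_subs` — shape `C₁ → C₂ → C₃ → C` for
`ledger route edit route-HodgeConjecture-BoundaryReadout --split HCOverNumberFields … --glue-by
Summit.HodgeConjecture.HodgeConjecture.Theorems.hcOverNumberFields_of_subs`: pure logic plus the DISCHARGED tree theorem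
`Literature.AlgebraicGeometry.HodgeTheory.nonempty_hodgeModel_holds` (the anti-vacuity conjunct
`Nonempty (HodgeModel n X)` of `HodgeConjectureFor`; Serre GAGA, de Rham, Hodge decomposition — relying on nothing
unproved); `absoluteHodgeAlgebraicNumberField_of_hcOverNumberFields` — the converse direction for the third
child (the parent gives it back outright, so the third child is WEAKER than the parent; the first two are not
consequences of the parent without "cycle classes are absolute Hodge", a theorem in print absent from the tree).
HONESTY: the conjunction of the children implies the parent (this file) and is implied by the Hodge conjecture
together with "cycle classes are absolute Hodge" (Deligne 1982 Ex. 2.1(a)); no child is the parent or the summit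
reworded (birth BC3 probes 6/6 fail, evidence `HCOverNumberFields_probes.lean` on the item). No new definitions;
standard axioms.
-/

-- `Summit.<Summit>.<Problem>` is the mandated summit-side namespace (CONVENTIONS §2); for the single-conjunct
-- summit `HodgeConjecture` the two coincide, so the duplicate `HodgeConjecture.HodgeConjecture` is deliberate.
set_option linter.dupNamespace false

noncomputable section

namespace Summit.HodgeConjecture.HodgeConjecture.Theorems

open CategoryTheory

/-- **Glue of the absolute-Hodge split of `HCOverNumberFields`.** If conjugates exist (`ConjugateClassesExist`),
every conjugate of a rational `(p,p)` class on an arithmetic variety is a twisted rational `(p,p)` class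
(`HodgeClassConjugatesNumberField`), and absolute Hodge classes on arithmetic varieties are algebraic
(`AbsoluteHodgeAlgebraicNumberField`), then the Hodge conjecture holds for every smooth projective complex
variety definable over a number field: the anti-vacuity conjunct `Nonempty (HodgeModel n X)` of
`HodgeConjectureFor` is the discharged tree theorem `nonempty_hodgeModel_holds`, and a rational `(p,p)` class is
absolute Hodge by the first two hypotheses (the definition `IsAbsoluteHodgeClass` assembled field by field), hence
algebraic by the third. Shape `C₁ → C₂ → C₃ → C` for `route edit --split … --glue-by`.
[cite: CharlesSchnell2014Notes, Def. 11.2.3 and §11.2.5] [cite: Voisin2007HodgeLoci, Prop. 1.2] -/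
theorem hcOverNumberFields_of_subs :
    (∀ ⦃n : ℕ⦄ ⦃X : Literature.AlgebraicGeometry.Motives.SchemeOver ℂ⦄,
      Literature.AlgebraicGeometry.Motives.IsSmoothProjective n X →
        ∀ (σ : ℂ ≃+* ℂ) (k : ℕ) (c : Literature.AlgebraicGeometry.HodgeTheory.complexBetti X k),
          ∃ c', Literature.AlgebraicGeometry.HodgeTheory.IsConjugateClass σ X k c c') →
    (∀ ⦃n : ℕ⦄ ⦃X : Literature.AlgebraicGeometry.Motives.SchemeOver ℂ⦄,
      Literature.AlgebraicGeometry.Motives.IsSmoothProjective n X →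
        (∃ (K : Type) (_ : Field K) (_ : NumberField K) (σ : K →+* ℂ)
            (X₀ : Literature.AlgebraicGeometry.Motives.SchemeOver K),
            Nonempty (X ≅ (Literature.AlgebraicGeometry.Motives.baseChangeHom σ).obj X₀)) →
          ∀ (p : ℕ) (c : Literature.AlgebraicGeometry.HodgeTheory.complexBetti X (2 * p)),
            Literature.AlgebraicGeometry.HodgeTheory.IsRationalClass c →
              Literature.AlgebraicGeometry.HodgeTheory.IsOfHodgeType n X (2 * p) p p c →
                ∀ (σ : ℂ ≃+* ℂ)
                  (c' : Literature.AlgebraicGeometry.HodgeTheory.complexBetti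
                    (Literature.AlgebraicGeometry.Motives.conjugateVariety σ X) (2 * p)),
                  Literature.AlgebraicGeometry.HodgeTheory.IsConjugateClass σ X (2 * p) c c' →
                    ∃ β : Literature.AlgebraicGeometry.HodgeTheory.complexBetti
                        (Literature.AlgebraicGeometry.Motives.conjugateVariety σ X) (2 * p),
                      Literature.AlgebraicGeometry.HodgeTheory.IsRationalClass β ∧
                        Literature.AlgebraicGeometry.HodgeTheory.IsOfHodgeType n
                          (Literature.AlgebraicGeometry.Motives.conjugateVariety σ X) (2 * p) p p β ∧
                          c' = Literature.AlgebraicGeometry.HodgeTheory.periodTwist σ p • β) →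
    (∀ ⦃n : ℕ⦄ ⦃X : Literature.AlgebraicGeometry.Motives.SchemeOver ℂ⦄,
      Literature.AlgebraicGeometry.Motives.IsSmoothProjective n X →
        (∃ (K : Type) (_ : Field K) (_ : NumberField K) (σ : K →+* ℂ)
            (X₀ : Literature.AlgebraicGeometry.Motives.SchemeOver K),
            Nonempty (X ≅ (Literature.AlgebraicGeometry.Motives.baseChangeHom σ).obj X₀)) →
          ∀ (p : ℕ) (c : Literature.AlgebraicGeometry.HodgeTheory.complexBetti X (2 * p)),
            Literature.AlgebraicGeometry.HodgeTheory.IsAbsoluteHodgeClass n X p c →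
              c ∈ Literature.AlgebraicGeometry.HodgeTheory.algebraicClasses X p) →
    Summit.HodgeConjecture.HodgeConjecture.Theses.BoundaryReadout.HCOverNumberFields := by
  intro h₁ h₂ h₃ n X hX hK
  refine ⟨Literature.AlgebraicGeometry.HodgeTheory.nonempty_hodgeModel_holds hX, fun p c hc hpp => ?_⟩
  exact h₃ hX hK p c
    ⟨hc, hpp, fun σ => ⟨h₁ hX σ (2 * p) c, fun c' hc' => h₂ hX hK p c hc hpp σ c' hc'⟩⟩

/-- **The third child is a consequence of the parent**: the Hodge conjecture for varieties definable over a number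
field gives, in particular, the algebraicity of their absolute Hodge classes (which are rational `(p,p)` classes).
Recorded so that the split's bookkeeping is two-sided for this leaf. [cite: CharlesSchnell2014Notes, Def. 11.2.3] -/
theorem absoluteHodgeAlgebraicNumberField_of_hcOverNumberFields
    (h : Summit.HodgeConjecture.HodgeConjecture.Theses.BoundaryReadout.HCOverNumberFields) :
    ∀ ⦃n : ℕ⦄ ⦃X : Literature.AlgebraicGeometry.Motives.SchemeOver ℂ⦄,
      Literature.AlgebraicGeometry.Motives.IsSmoothProjective n X →
        (∃ (K : Type) (_ : Field K) (_ : NumberField K) (σ : K →+* ℂ)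
            (X₀ : Literature.AlgebraicGeometry.Motives.SchemeOver K),
            Nonempty (X ≅ (Literature.AlgebraicGeometry.Motives.baseChangeHom σ).obj X₀)) →
          ∀ (p : ℕ) (c : Literature.AlgebraicGeometry.HodgeTheory.complexBetti X (2 * p)),
            Literature.AlgebraicGeometry.HodgeTheory.IsAbsoluteHodgeClass n X p c →
              c ∈ Literature.AlgebraicGeometry.HodgeTheory.algebraicClasses X p :=
  fun _n _X hX hK p c hc => (h hX hK).2 p c hc.1 hc.2.1

end Summit.HodgeConjecture.HodgeConjecture.Theorems

end
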